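import Mathlib
import Summits.MatrixMultiplication.MatrixMultiplication.Theorems.GradedDesignFamily.Negative.SubfieldCellUnipotent

/-!
# Subfield cell — auxiliary lemmas for the overgroup bound (route (D′), step (O))

HONEST FRAMING. This file is part of the NEGATIVE decision of the subfield-cell stub `S3` of
`LevelGradedCohnUmans.GradedDesignFamily`; its value is a handful of elementary, reusable
`2 × 2` linear-algebra facts over a field extension `ι : k →+* K` — NOT summit progress.

Contents (all folklore):
* the standard embedding `a ↦ toGL (map ι a)` on matrices, root elements and the Weyl element;
* kernel vectors of `B.map ι` for a nonzero `k`-matrix `B` are `K`-multiples of `k`-rational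
  vectors; consequences for eigenvectors that are not `k`-rational;
* `k`-rational lines are the point `[1 : 0]` or a point `[ι x : 1]` of the projective line;
* entries of the inverse of an upper-triangular invertible `2 × 2` matrix, and conjugation of a
  root element by an upper-triangular matrix of determinant one;
* the eigenvalue trichotomy: if `a ∈ SL₂(k)` has a non-rational eigenvector with eigenvalue `θ`
  and `θ ^ 2 ∈ ι k`, then `θ = 1`, `θ = -1` or `θ ^ 2 + 1 = 0`.

Sorry-free. [folklore]
-/

set_option linter.dupNamespace false

open Matrix

namespace Summit.MatrixMultiplication.MatrixMultiplication.Theorems.GradedDesignFamily.Negative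

section OvergroupsAux

variable {k K : Type} [Field k] [Field K] (ι : k →+* K)

/-- The standard embedding on matrices. [folklore] -/
theorem subfieldCell_std_coe (a : Matrix.SpecialLinearGroup (Fin 2) k) :
    ((Matrix.SpecialLinearGroup.toGL (Matrix.SpecialLinearGroup.map ι a) :
        Matrix.GeneralLinearGroup (Fin 2) K) : Matrix (Fin 2) (Fin 2) K) =
      (a : Matrix (Fin 2) (Fin 2) k).map ι := rfl

/-- The standard embedding sends upper root elements to upper root elements. [folklore] -/
theorem subfieldCell_std_upper (b : k) :
    Matrix.SpecialLinearGroup.toGL (Matrix.SpecialLinearGroup.map ι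
        (⟨!![(1 : k), b; 0, 1], sl2md_det_upper b⟩ : Matrix.SpecialLinearGroup (Fin 2) k)) =
      Matrix.SpecialLinearGroup.toGL
        (⟨!![(1 : K), ι b; 0, 1], sl2md_det_upper (ι b)⟩ : Matrix.SpecialLinearGroup (Fin 2) K) := by
  congr 1
  ext i j
  fin_cases i <;> fin_cases j <;> simp

/-- The standard embedding fixes the Weyl element. [folklore] -/
theorem subfieldCell_std_weyl :
    Matrix.SpecialLinearGroup.toGL (Matrix.SpecialLinearGroup.map ι
        (⟨!![(0 : k), 1; -1, 0], sl2md_det_weyl⟩ : Matrix.SpecialLinearGroup (Fin 2) k)) =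
      Matrix.SpecialLinearGroup.toGL
        (⟨!![(0 : K), 1; -1, 0], sl2md_det_weyl⟩ : Matrix.SpecialLinearGroup (Fin 2) K) := by
  congr 1
  ext i j
  fin_cases i <;> fin_cases j <;> simp

omit [Field k] in
/-- Lower root elements are Weyl-conjugates of upper root elements. [folklore] -/
theorem subfieldCell_lower_eq_conj (x : K) :
    ((⟨!![(0 : K), 1; -1, 0], sl2md_det_weyl⟩ * ⟨!![(1 : K), -x; 0, 1], sl2md_det_upper (-x)⟩ *
        ⟨!![(0 : K), 1; -1, 0], sl2md_det_weyl⟩⁻¹ : Matrix.SpecialLinearGroup (Fin 2) K)) =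
      ⟨!![(1 : K), 0; x, 1], sl2md_det_lower x⟩ := by
  rw [mul_inv_eq_iff_eq_mul, sl2md_weyl_mul_upper]

/-- A nonzero `k`-matrix whose base change kills a nonzero vector `v` forces `v` to be a
multiple of a `k`-rational vector. [folklore] -/
theorem subfieldCell_exists_smul_of_map_mulVec_eq_zero (B : Matrix (Fin 2) (Fin 2) k) (hB : B ≠ 0)
    (v : Fin 2 → K) (hv : v ≠ 0) (h : (B.map ι) *ᵥ v = 0) :
    ∃ (c : K) (a : Fin 2 → k), a ≠ 0 ∧ v = c • (fun i => ι (a i)) := by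
  classical
  have hdet : B.det = 0 := by
    have h1 : (B.map ι).det = 0 := Matrix.exists_mulVec_eq_zero_iff.1 ⟨v, hv, h⟩
    rw [← RingHom.mapMatrix_apply, ← RingHom.map_det] at h1
    exact (map_eq_zero_iff ι ι.injective).1 h1
  obtain ⟨a, ha, hBa⟩ := Matrix.exists_mulVec_eq_zero_iff.2 hdet
  have hιa : (fun i => ι (a i)) ≠ 0 := by
    intro h0
    apply ha
    funext i
    have := congr_fun h0 i
    exact (map_eq_zero_iff ι ι.injective).1 (by simpa using this)
  have hker : (B.map ι) *ᵥ (fun i => ι (a i)) = 0 := by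
    funext i
    have := RingHom.map_mulVec ι B a i
    rw [hBa, Pi.zero_apply, map_zero] at this
    rw [Pi.zero_apply, show (fun i => ι (a i)) = ι ∘ a from rfl, ← this]
  have hN : B.map ι ≠ 0 := by
    intro h0
    apply hB
    ext i j
    have := congr_fun (congr_fun h0 i) j
    exact (map_eq_zero_iff ι ι.injective).1 (by simpa using this)
  obtain ⟨c, hc⟩ := fin_two_exists_smul_of_mulVec_eq_zero (B.map ι) hN _ v hιa hker h
  exact ⟨c, a, ha, hc⟩

/-- Base change of `a - a'` applied to a vector. [folklore] -/
theorem subfieldCell_map_sub_mulVec (a a' : Matrix (Fin 2) (Fin 2) k) (v : Fin 2 → K) :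
    ((a - a').map ι) *ᵥ v = (a.map ι) *ᵥ v - (a'.map ι) *ᵥ v := by
  ext i
  fin_cases i <;> simp [Matrix.mulVec, dotProduct, Fin.sum_univ_two] <;> ring

/-- Base change of `a - t • 1` applied to a vector. [folklore] -/
theorem subfieldCell_map_sub_smul_one_mulVec (a : Matrix (Fin 2) (Fin 2) k) (t : k)
    (v : Fin 2 → K) :
    ((a - t • (1 : Matrix (Fin 2) (Fin 2) k)).map ι) *ᵥ v = (a.map ι) *ᵥ v - ι t • v := by
  ext i
  fin_cases i <;> simp [Matrix.mulVec, dotProduct, Fin.sum_univ_two, Matrix.one_apply] <;> ring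

/-- A `k`-matrix with a non-rational eigenvector for a `k`-rational eigenvalue is scalar.
[folklore] -/
theorem subfieldCell_eq_smul_one_of_eigen (a : Matrix (Fin 2) (Fin 2) k) (t : k)
    (v : Fin 2 → K) (hv : v ≠ 0)
    (hnr : ¬ ∃ (c : K) (a' : Fin 2 → k), a' ≠ 0 ∧ v = c • (fun i => ι (a' i)))
    (h : (a.map ι) *ᵥ v = ι t • v) : a = t • (1 : Matrix (Fin 2) (Fin 2) k) := by
  by_contra hne
  apply hnr
  refine subfieldCell_exists_smul_of_map_mulVec_eq_zero ι (a - t • 1) (sub_ne_zero.2 hne) v hv ?_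
  rw [subfieldCell_map_sub_smul_one_mulVec, h, sub_self]

/-- Two `k`-matrices agreeing on a non-rational vector are equal. [folklore] -/
theorem subfieldCell_eq_of_map_mulVec_eq (a a' : Matrix (Fin 2) (Fin 2) k)
    (v : Fin 2 → K) (hv : v ≠ 0)
    (hnr : ¬ ∃ (c : K) (b : Fin 2 → k), b ≠ 0 ∧ v = c • (fun i => ι (b i)))
    (h : (a.map ι) *ᵥ v = (a'.map ι) *ᵥ v) : a = a' := by
  by_contra hne
  apply hnr
  refine subfieldCell_exists_smul_of_map_mulVec_eq_zero ι (a - a') (sub_ne_zero.2 hne) v hv ?_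
  rw [subfieldCell_map_sub_mulVec, h, sub_self]

/-- A `k`-rational line is `[1 : 0]` or `[ι x : 1]`. [folklore] -/
theorem subfieldCell_mk_rational (c : K) (a : Fin 2 → k)
    (hv : c • (fun i => ι (a i)) ≠ 0) :
    Projectivization.mk K (c • fun i => ι (a i)) hv =
        Projectivization.mk K ![(1 : K), 0] (by simp) ∨
      ∃ x : k, Projectivization.mk K (c • fun i => ι (a i)) hv =
        Projectivization.mk K ![ι x, 1] (by simp) := by
  by_cases h1 : a 1 = 0
  · left
    rw [Projectivization.mk_eq_mk_iff']
    refine ⟨c * ι (a 0), ?_⟩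
    ext i
    fin_cases i <;> simp [h1]
  · right
    refine ⟨a 0 / a 1, ?_⟩
    rw [Projectivization.mk_eq_mk_iff']
    refine ⟨c * ι (a 1), ?_⟩
    have h1' : ι (a 1) ≠ 0 := (map_ne_zero_iff ι ι.injective).2 h1
    ext i
    fin_cases i
    · simp [map_div₀]
      field_simp
    · simp

omit [Field k] in
/-- Entries of the inverse of an upper-triangular invertible matrix. [folklore] -/
theorem subfieldCell_inv_entries (g : Matrix.GeneralLinearGroup (Fin 2) K)
    (h10 : (g : Matrix (Fin 2) (Fin 2) K) 1 0 = 0) :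
    ((g⁻¹ : Matrix.GeneralLinearGroup (Fin 2) K) : Matrix (Fin 2) (Fin 2) K) 1 0 = 0 ∧
      ((g⁻¹ : Matrix.GeneralLinearGroup (Fin 2) K) : Matrix (Fin 2) (Fin 2) K) 0 0 *
        (g : Matrix (Fin 2) (Fin 2) K) 0 0 = 1 := by
  have h := Units.inv_mul g
  have e10 := congr_fun (congr_fun h 1) 0
  have e00 := congr_fun (congr_fun h 0) 0
  simp only [Matrix.mul_apply, Fin.sum_univ_two, h10, mul_zero, add_zero, Matrix.one_apply_eq,
    Matrix.one_apply_ne (show (1 : Fin 2) ≠ 0 by decide)] at e10 e00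
  have hg00 : (g : Matrix (Fin 2) (Fin 2) K) 0 0 ≠ 0 := by
    intro h0
    rw [h0, mul_zero] at e00
    exact zero_ne_one e00
  exact ⟨(mul_eq_zero.1 e10).resolve_right hg00, e00⟩

omit [Field k] in
/-- An invertible matrix fixing the first basis vector and of determinant one is an upper root
element. [folklore] -/
theorem subfieldCell_GL_eq_upper (X : Matrix.GeneralLinearGroup (Fin 2) K)
    (h00 : (X : Matrix (Fin 2) (Fin 2) K) 0 0 = 1) (h10 : (X : Matrix (Fin 2) (Fin 2) K) 1 0 = 0)
    (hdet : (X : Matrix (Fin 2) (Fin 2) K).det = 1) :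
    X = Matrix.SpecialLinearGroup.toGL
        (⟨!![(1 : K), (X : Matrix (Fin 2) (Fin 2) K) 0 1; 0, 1], sl2md_det_upper _⟩ :
          Matrix.SpecialLinearGroup (Fin 2) K) := by
  rw [Matrix.det_fin_two, h00, h10, one_mul, mul_zero, sub_zero] at hdet
  apply Units.ext
  rw [Matrix.SpecialLinearGroup.coe_GL_coe_matrix]
  ext i j
  fin_cases i <;> fin_cases j <;> simp [h00, h10, hdet]

omit [Field k] in
/-- Conjugating an upper root element by an upper-triangular matrix of determinant one rescales
the root by the square of the diagonal entry. [folklore] -/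
theorem subfieldCell_upper_conj_root (g : Matrix.GeneralLinearGroup (Fin 2) K)
    (h10 : (g : Matrix (Fin 2) (Fin 2) K) 1 0 = 0) (hdet : (g : Matrix (Fin 2) (Fin 2) K).det = 1)
    (x : K) :
    g * Matrix.SpecialLinearGroup.toGL
        (⟨!![(1 : K), x; 0, 1], sl2md_det_upper x⟩ : Matrix.SpecialLinearGroup (Fin 2) K) * g⁻¹ =
      Matrix.SpecialLinearGroup.toGL
        (⟨!![(1 : K), (g : Matrix (Fin 2) (Fin 2) K) 0 0 ^ 2 * x; 0, 1],
          sl2md_det_upper _⟩ : Matrix.SpecialLinearGroup (Fin 2) K) := by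
  rw [mul_inv_eq_iff_eq_mul]
  apply Units.ext
  rw [Units.val_mul, Units.val_mul, Matrix.SpecialLinearGroup.coe_GL_coe_matrix,
    Matrix.SpecialLinearGroup.coe_GL_coe_matrix]
  rw [Matrix.det_fin_two, h10, mul_zero, sub_zero] at hdet
  ext i j
  fin_cases i <;> fin_cases j <;>
    simp [Matrix.mul_apply, Fin.sum_univ_two, h10]
  linear_combination (-((g : Matrix (Fin 2) (Fin 2) K) 0 0 * x)) * hdet

/-- Eigenvalue trichotomy: an element of `SL₂(k)` with a non-rational eigenvector whose
eigenvalue has `k`-rational square has eigenvalue `1`, `-1` or a square root of `-1`.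
[folklore] -/
theorem subfieldCell_eigen_trichotomy (a : Matrix.SpecialLinearGroup (Fin 2) k)
    (v : Fin 2 → K) (hv : v ≠ 0)
    (hnr : ¬ ∃ (c : K) (b : Fin 2 → k), b ≠ 0 ∧ v = c • (fun i => ι (b i)))
    (θ : K) (hθ : ((a : Matrix (Fin 2) (Fin 2) k).map ι) *ᵥ v = θ • v)
    (hsq : ∃ r : k, ι r = θ ^ 2) :
    θ = 1 ∨ θ = -1 ∨ θ ^ 2 + 1 = 0 := by
  obtain ⟨r, hr⟩ := hsq
  set N := (a : Matrix (Fin 2) (Fin 2) k).map ι with hN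
  have hNdet : N 0 0 * N 1 1 - N 0 1 * N 1 0 = 1 := by
    rw [← Matrix.det_fin_two, hN, ← RingHom.mapMatrix_apply, ← RingHom.map_det, a.prop, map_one]
  have hτ : N 0 0 + N 1 1 =
      ι ((a : Matrix (Fin 2) (Fin 2) k) 0 0 + (a : Matrix (Fin 2) (Fin 2) k) 1 1) := by
    simp [hN]
  -- Cayley–Hamilton on the eigenvector
  obtain ⟨i, hi⟩ : ∃ i, v i ≠ 0 := by
    by_contra h0
    push Not at h0
    exact hv (funext h0)
  have hCH : θ ^ 2 - (N 0 0 + N 1 1) * θ + 1 = 0 := by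
    have h2 : N *ᵥ (N *ᵥ v) = (θ * θ) • v := by rw [hθ, Matrix.mulVec_smul, hθ, smul_smul]
    rw [Matrix.mulVec_mulVec, fin_two_mul_self N, hNdet, one_smul, Matrix.sub_mulVec,
      Matrix.smul_mulVec, hθ, Matrix.one_mulVec] at h2
    have h3 := congr_fun h2 i
    simp only [Pi.sub_apply, Pi.smul_apply, smul_eq_mul] at h3
    have h4 : (θ ^ 2 - (N 0 0 + N 1 1) * θ + 1) * v i = 0 := by linear_combination -h3
    exact (mul_eq_zero.1 h4).resolve_right hi
  by_cases htr : (a : Matrix (Fin 2) (Fin 2) k) 0 0 + (a : Matrix (Fin 2) (Fin 2) k) 1 1 = 0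
  · right; right
    rw [hτ, htr, map_zero] at hCH
    linear_combination hCH
  · set t := (r + 1) / ((a : Matrix (Fin 2) (Fin 2) k) 0 0 + (a : Matrix (Fin 2) (Fin 2) k) 1 1)
      with ht
    have hθt : θ = ι t := by
      rw [ht, map_div₀, map_add, map_one, hr,
        eq_div_iff ((map_ne_zero_iff ι ι.injective).2 htr)]
      rw [hτ] at hCH
      linear_combination -hCH
    have hat := subfieldCell_eq_smul_one_of_eigen ι (a : Matrix (Fin 2) (Fin 2) k) t v hv hnr
      (by rw [← hθt]; exact hθ)
    have ht2 : t * t = 1 := by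
      have hdet := a.prop
      rw [hat, Matrix.det_smul, Matrix.det_one, mul_one, Fintype.card_fin] at hdet
      rw [← sq]; exact hdet
    rcases mul_self_eq_one_iff.1 ht2 with h1 | h1
    · left; rw [hθt, h1, map_one]
    · right; left; rw [hθt, h1, map_neg, map_one]

end OvergroupsAux

end Summit.MatrixMultiplication.MatrixMultiplication.Theorems.GradedDesignFamily.Negative
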